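import Summits.QuantumFields.YangMills.Theorems.SoloBlindOddTorusSlabRP
import HarnessLib

/-!
# Solo-blind rung D8 (part 9): endpoint reduction for slab observables on the odd torus

`Summit.QuantumFields.YangMills.Theorems.SoloBlindOddTorusSlabDecay` (read-only conjunct
`YangMills`).

Part 8 showed that for a `[-T', T]`-slab observable `F` on the odd torus `L = 2m + 1` the OS
norms `P_{F,F}(n) = ⟨(F∘Θ')·F(· + n e₀)⟩` are nonnegative and log-convex along ODD `n` and that
the even ones are sandwiched (`β ≥ 0`, any compact `G`).  Consequently geometric decay of the
whole diagonal sequence, and of every mixed pairing `P_{F,G}`, on the range the statement's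
`HasLatticeMassGap` clause quantifies over, follows from geometric bounds at THREE indices only:
the first admissible odd index `2T' + 1` and the two ANTIPODAL indices `m`, `m + 1`
(`m ≥ 2T + 2`, `m ≥ 2T' + 2`):

* `osPairingSeq_odd_le_of_endpoints` — `P_{F,F}(n) ≤ K ϑⁿ` for odd `2T' + 1 ≤ n ≤ m + 1`;
* `osPairingSeq_even_abs_le_of_endpoints` — `|P_{F,F}(n)| ≤ K ϑⁿ` for even `2T' + 2 ≤ n ≤ m`;
* `osPairingSeq_abs_le_of_endpoints` — both together on `2T' + 1 ≤ n ≤ m`;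
* `osPairingSeq_mixed_sq_le` — `P_{F,G}(n)² ≤ K_F K_G ϑ^{2n}` on `2T'ᵢ + 2 ≤ n ≤ m` from the
  odd-index bounds for `F` and `G` (OS Schwarz inequality, part 8).

As in parts 4–7 the content is organisational: WHERE a proof of the lattice mass gap has to
deliver decay (at the antipode of the statement's own odd tori), not decay itself.
[folklore: transfer-matrix/spectral structure of RP lattice theories, Seiler LNP 159 Ch. 2]
-/

open MeasureTheory
open Literature.MathematicalPhysics.QuantumFieldTheory

noncomputable section

namespace Summit.QuantumFields.YangMills.Theorems.SoloBlind

variable {d L N : ℕ} [NeZero d] [NeZero L] {G : Type*} [Group G] [TopologicalSpace G]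
  [IsTopologicalGroup G] [CompactSpace G] [MeasurableSpace G] [BorelSpace G]
  (ρ : G →* Matrix (Fin N) (Fin N) ℂ)

/-- **Odd indices.**  For a `[-T', T]`-slab observable on the odd torus `L = 2m + 1`
(`m ≥ 2T + 2`, `m ≥ 2T' + 2`, `β ≥ 0`, `ϑ > 0`): if `P(2T' + 1) ≤ K ϑ^{2T'+1}`, `P(m) ≤ K ϑ^m`
and `P(m + 1) ≤ K ϑ^{m+1}`, then `P(n) ≤ K ϑⁿ` for every odd `n` with `2T' + 1 ≤ n ≤ m + 1`
(log-convexity of the odd subsequence between its endpoints). [this unit's; elementary] -/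
theorem osPairingSeq_odd_le_of_endpoints {m : ℕ} (hL : L = 2 * m + 1) (hρ : Continuous ρ)
    {β : ℝ} (hβ : 0 ≤ β) {F : GaugeConfig d L G → ℝ} (hFm : Measurable F)
    (hFb : ∃ C : ℝ, ∀ U, |F U| ≤ C) {T' T : ℕ} (hFs : DependsOn F (slabEdges T' T))
    (hT : 2 * T + 2 ≤ m) (hT' : 2 * T' + 2 ≤ m) {K ϑ : ℝ} (hϑ : 0 < ϑ)
    (hlo : osPairingSeq ρ β F F (2 * T' + 1) ≤ K * ϑ ^ (2 * T' + 1))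
    (hm0 : osPairingSeq ρ β F F m ≤ K * ϑ ^ m)
    (hm1 : osPairingSeq ρ β F F (m + 1) ≤ K * ϑ ^ (m + 1))
    {n : ℕ} (hodd : Odd n) (hn1 : 2 * T' + 1 ≤ n) (hn2 : n ≤ m + 1) :
    osPairingSeq ρ β F F n ≤ K * ϑ ^ n := by
  have hm : 1 ≤ m := by omega
  obtain ⟨js, hjs1, hjs2, hjsK⟩ : ∃ js : ℕ, m ≤ 2 * js + 1 ∧ 2 * js + 1 ≤ m + 1 ∧
      osPairingSeq ρ β F F (2 * js + 1) ≤ K * ϑ ^ (2 * js + 1) := by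
    rcases Nat.even_or_odd m with ⟨j, hj⟩ | ⟨j, hj⟩
    · exact ⟨j, by omega, by omega, by rw [show 2 * j + 1 = m + 1 by omega]; exact hm1⟩
    · exact ⟨j, by omega, by omega, by rw [show 2 * j + 1 = m by omega]; exact hm0⟩
  set a : ℕ → ℝ := fun k => osPairingSeq ρ β F F (2 * (T' + k) + 1) with ha
  have h0 : ∀ k, k ≤ js - T' → 0 ≤ a k := fun k hk =>
    osPairingSeq_odd_nonneg ρ hL hm hρ hβ hFm hFb hFs (n := T' + k) (by omega) (by omega)
  have hconv : ∀ k, k + 2 ≤ js - T' → a (k + 1) ^ 2 ≤ a k * a (k + 2) := by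
    intro k hk
    have h := osPairingSeq_odd_logConvex ρ hL hm hρ hβ hFm hFb hFs (n := T' + k + 1)
      (by omega) (by omega)
    have e1 : 2 * (T' + k + 1) - 1 = 2 * (T' + k) + 1 := by omega
    have e2 : 2 * (T' + k + 1) + 3 = 2 * (T' + (k + 2)) + 1 := by omega
    have e3 : 2 * (T' + k + 1) + 1 = 2 * (T' + (k + 1)) + 1 := by omega
    rw [e1, e2, e3] at h
    exact h
  have hC0 : a 0 ≤ K * ϑ ^ (2 * T' + 1) := by
    have e : 2 * (T' + 0) + 1 = 2 * T' + 1 := by omega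
    simp only [ha, e]
    exact hlo
  have hCK : a (js - T') ≤ K * ϑ ^ (2 * T' + 1) * (ϑ ^ 2) ^ (js - T') := by
    have e : 2 * (T' + (js - T')) + 1 = 2 * js + 1 := by omega
    have e' : K * ϑ ^ (2 * T' + 1) * (ϑ ^ 2) ^ (js - T') = K * ϑ ^ (2 * js + 1) := by
      rw [← pow_mul, mul_assoc, ← pow_add]
      congr 2
      omega
    simp only [ha, e]
    rw [e']
    exact hjsK
  obtain ⟨k, hk1, hk2⟩ : ∃ k, n = 2 * (T' + k) + 1 ∧ k ≤ js - T' := by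
    obtain ⟨q, hq⟩ := hodd
    exact ⟨q - T', by omega, by omega⟩
  have hres := mulConvex_le_geometric h0 hconv (pow_pos hϑ 2) hC0 hCK hk2
  have e' : K * ϑ ^ (2 * T' + 1) * (ϑ ^ 2) ^ k = K * ϑ ^ (2 * (T' + k) + 1) := by
    rw [← pow_mul, mul_assoc, ← pow_add]
    congr 2
    omega
  rw [hk1, ← e']
  exact hres

/-- `0 ≤ K` under the hypotheses of the endpoint reduction (the first OS norm is nonnegative). -/
theorem K_nonneg_of_lo {m : ℕ} (hL : L = 2 * m + 1) (hρ : Continuous ρ) {β : ℝ} (hβ : 0 ≤ β)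
    {F : GaugeConfig d L G → ℝ} (hFm : Measurable F) (hFb : ∃ C : ℝ, ∀ U, |F U| ≤ C)
    {T' T : ℕ} (hFs : DependsOn F (slabEdges T' T)) (hT : 2 * T + 2 ≤ m) (hT' : 2 * T' + 2 ≤ m)
    {K ϑ : ℝ} (hϑ : 0 < ϑ) (hlo : osPairingSeq ρ β F F (2 * T' + 1) ≤ K * ϑ ^ (2 * T' + 1)) :
    0 ≤ K := by
  have h0 := osPairingSeq_odd_nonneg ρ hL (by omega) hρ hβ hFm hFb hFs (n := T') le_rfl
    (by omega)
  have hpos : 0 < ϑ ^ (2 * T' + 1) := pow_pos hϑ _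
  nlinarith

/-- **Even indices.**  Under the same three endpoint bounds, `|P(n)| ≤ K ϑⁿ` for every even `n`
with `2T' + 2 ≤ n ≤ m` (sandwich between the odd neighbours). [this unit's; elementary] -/
theorem osPairingSeq_even_abs_le_of_endpoints {m : ℕ} (hL : L = 2 * m + 1) (hρ : Continuous ρ)
    {β : ℝ} (hβ : 0 ≤ β) {F : GaugeConfig d L G → ℝ} (hFm : Measurable F)
    (hFb : ∃ C : ℝ, ∀ U, |F U| ≤ C) {T' T : ℕ} (hFs : DependsOn F (slabEdges T' T))
    (hT : 2 * T + 2 ≤ m) (hT' : 2 * T' + 2 ≤ m) {K ϑ : ℝ} (hϑ : 0 < ϑ)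
    (hlo : osPairingSeq ρ β F F (2 * T' + 1) ≤ K * ϑ ^ (2 * T' + 1))
    (hm0 : osPairingSeq ρ β F F m ≤ K * ϑ ^ m)
    (hm1 : osPairingSeq ρ β F F (m + 1) ≤ K * ϑ ^ (m + 1))
    {n : ℕ} (heven : Even n) (hn1 : 2 * T' + 2 ≤ n) (hn2 : n ≤ m) :
    |osPairingSeq ρ β F F n| ≤ K * ϑ ^ n := by
  have hm : 1 ≤ m := by omega
  obtain ⟨q, hq⟩ := heven
  have hK := K_nonneg_of_lo ρ hL hρ hβ hFm hFb hFs hT hT' hϑ hlo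
  have hsq := osPairingSeq_even_sq_le ρ hL hm hρ hβ hFm hFb hFs (n := q) (by omega) (by omega)
  have h1 := osPairingSeq_odd_le_of_endpoints ρ hL hρ hβ hFm hFb hFs hT hT' hϑ hlo hm0 hm1
    (n := 2 * q - 1) ⟨q - 1, by omega⟩ (by omega) (by omega)
  have h2 := osPairingSeq_odd_le_of_endpoints ρ hL hρ hβ hFm hFb hFs hT hT' hϑ hlo hm0 hm1
    (n := 2 * q + 1) ⟨q, by omega⟩ (by omega) (by omega)
  have hp1 : 0 ≤ osPairingSeq ρ β F F (2 * q - 1) := by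
    have h := osPairingSeq_odd_nonneg ρ hL hm hρ hβ hFm hFb hFs (n := q - 1) (by omega) (by omega)
    rw [show 2 * (q - 1) + 1 = 2 * q - 1 by omega] at h
    exact h
  have hp2 : 0 ≤ osPairingSeq ρ β F F (2 * q + 1) :=
    osPairingSeq_odd_nonneg ρ hL hm hρ hβ hFm hFb hFs (n := q) (by omega) (by omega)
  have hn : n = 2 * q := by omega
  rw [hn]
  apply abs_le_of_sq_le_sq _ (mul_nonneg hK (pow_nonneg hϑ.le _))
  calc osPairingSeq ρ β F F (2 * q) ^ 2
      ≤ osPairingSeq ρ β F F (2 * q - 1) * osPairingSeq ρ β F F (2 * q + 1) := hsq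
    _ ≤ (K * ϑ ^ (2 * q - 1)) * (K * ϑ ^ (2 * q + 1)) := mul_le_mul h1 h2 hp2 (hp1.trans h1)
    _ = (K * ϑ ^ (2 * q)) ^ 2 := by
        rw [show (K * ϑ ^ (2 * q - 1)) * (K * ϑ ^ (2 * q + 1)) = K * K * (ϑ ^ (2 * q - 1) *
          ϑ ^ (2 * q + 1)) by ring, ← pow_add, show 2 * q - 1 + (2 * q + 1) = 2 * (2 * q) by omega,
          pow_mul]
        ring

/-- **All indices.**  Under the three endpoint bounds, `|P_{F,F}(n)| ≤ K ϑⁿ` for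
`2T' + 1 ≤ n ≤ m`. [this unit's; elementary] -/
theorem osPairingSeq_abs_le_of_endpoints {m : ℕ} (hL : L = 2 * m + 1) (hρ : Continuous ρ)
    {β : ℝ} (hβ : 0 ≤ β) {F : GaugeConfig d L G → ℝ} (hFm : Measurable F)
    (hFb : ∃ C : ℝ, ∀ U, |F U| ≤ C) {T' T : ℕ} (hFs : DependsOn F (slabEdges T' T))
    (hT : 2 * T + 2 ≤ m) (hT' : 2 * T' + 2 ≤ m) {K ϑ : ℝ} (hϑ : 0 < ϑ)
    (hlo : osPairingSeq ρ β F F (2 * T' + 1) ≤ K * ϑ ^ (2 * T' + 1))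
    (hm0 : osPairingSeq ρ β F F m ≤ K * ϑ ^ m)
    (hm1 : osPairingSeq ρ β F F (m + 1) ≤ K * ϑ ^ (m + 1))
    {n : ℕ} (hn1 : 2 * T' + 1 ≤ n) (hn2 : n ≤ m) :
    |osPairingSeq ρ β F F n| ≤ K * ϑ ^ n := by
  rcases Nat.even_or_odd n with he | ho
  · exact osPairingSeq_even_abs_le_of_endpoints ρ hL hρ hβ hFm hFb hFs hT hT' hϑ hlo hm0 hm1 he
      (by obtain ⟨q, hq⟩ := he; omega) hn2
  · have h := osPairingSeq_odd_le_of_endpoints ρ hL hρ hβ hFm hFb hFs hT hT' hϑ hlo hm0 hm1 ho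
      hn1 (by omega)
    have h0 : 0 ≤ osPairingSeq ρ β F F n := by
      obtain ⟨q, hq⟩ := ho
      rw [hq]
      exact osPairingSeq_odd_nonneg ρ hL (by omega) hρ hβ hFm hFb hFs (n := q) (by omega)
        (by omega)
    rwa [abs_of_nonneg h0]

/-- **Mixed pairings.**  If the odd-index OS norms of a `[-T'₁, T₁]`-slab `F` and a
`[-T'₂, T₂]`-slab `G` obey `P_{F,F}(j) ≤ K₁ ϑ^j`, `P_{G,G}(j) ≤ K₂ ϑ^j` for odd
`2T'ᵢ + 1 ≤ j ≤ m + 1`, then `P_{F,G}(n)² ≤ K₁ K₂ ϑ^{2n}` for `2T'ᵢ + 2 ≤ n ≤ m`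
(OS Schwarz inequality with slices of total height `n + 1`). [this unit's; elementary] -/
theorem osPairingSeq_mixed_sq_le {m : ℕ} (hL : L = 2 * m + 1) (hρ : Continuous ρ) {β : ℝ}
    (hβ : 0 ≤ β) {F F₂ : GaugeConfig d L G → ℝ} (hFm : Measurable F)
    (hFb : ∃ C : ℝ, ∀ U, |F U| ≤ C) {T'₁ T₁ : ℕ} (hFs : DependsOn F (slabEdges T'₁ T₁))
    (hGm : Measurable F₂) (hGb : ∃ C : ℝ, ∀ U, |F₂ U| ≤ C) {T'₂ T₂ : ℕ}
    (hGs : DependsOn F₂ (slabEdges T'₂ T₂)) (hT₁ : 2 * T₁ + 2 ≤ m) (hT₂ : 2 * T₂ + 2 ≤ m)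
    {K₁ K₂ ϑ : ℝ}
    (h₁ : ∀ j, Odd j → 2 * T'₁ + 1 ≤ j → j ≤ m + 1 → osPairingSeq ρ β F F j ≤ K₁ * ϑ ^ j)
    (h₂ : ∀ j, Odd j → 2 * T'₂ + 1 ≤ j → j ≤ m + 1 → osPairingSeq ρ β F₂ F₂ j ≤ K₂ * ϑ ^ j)
    {n : ℕ} (hn1 : 2 * T'₁ + 2 ≤ n) (hn1' : 2 * T'₂ + 2 ≤ n) (hn2 : n ≤ m) :
    osPairingSeq ρ β F F₂ n ^ 2 ≤ K₁ * K₂ * ϑ ^ (2 * n) := by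
  have hm : 1 ≤ m := by omega
  -- two odd indices `2u + 1`, `2u' + 1` with sum `2n`, inside the admissible ranges
  obtain ⟨u, u', hsum, hu1, hu2, hu'1, hu'2⟩ : ∃ u u' : ℕ, u + u' + 1 = n ∧ T'₁ ≤ u ∧
      2 * u + 1 ≤ m + 1 ∧ T'₂ ≤ u' ∧ 2 * u' + 1 ≤ m + 1 := by
    rcases Nat.even_or_odd n with ⟨q, hq⟩ | ⟨q, hq⟩
    · exact ⟨q - 1, q, by omega, by omega, by omega, by omega, by omega⟩
    · exact ⟨q, q, by omega, by omega, by omega, by omega, by omega⟩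
  have hLodd : Odd L := ⟨m, hL⟩
  have hdiv : L / 2 = m := by omega
  have hv : ((u + 1 : ℕ) : ZMod L).val = u + 1 := by
    rw [ZMod.val_natCast]; exact Nat.mod_eq_of_lt (by omega)
  have hv' : ((u' + 1 : ℕ) : ZMod L).val = u' + 1 := by
    rw [ZMod.val_natCast]; exact Nat.mod_eq_of_lt (by omega)
  have hS := osPairing_schwarz ρ hLodd (by omega) hρ hβ hFm hFb hFs hGm hGb hGs
    (t := ((u + 1 : ℕ) : ZMod L)) (t' := ((u' + 1 : ℕ) : ZMod L)) (by rw [hv]; omega)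
    (by rw [hv, hdiv]; omega) (by rw [hv']; omega) (by rw [hv', hdiv]; omega)
  have c1 : ((u + 1 : ℕ) : ZMod L) + ((u' + 1 : ℕ) : ZMod L) - 1 = ((n : ℕ) : ZMod L) := by
    rw [← hsum]; push_cast; ring
  have c2 : (2 : ZMod L) * ((u + 1 : ℕ) : ZMod L) - 1 = ((2 * u + 1 : ℕ) : ZMod L) := by
    push_cast; ring
  have c3 : (2 : ZMod L) * ((u' + 1 : ℕ) : ZMod L) - 1 = ((2 * u' + 1 : ℕ) : ZMod L) := by
    push_cast; ring
  rw [c1, c2, c3] at hS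
  have hb1 := h₁ (2 * u + 1) ⟨u, rfl⟩ (by omega) hu2
  have hb2 := h₂ (2 * u' + 1) ⟨u', rfl⟩ (by omega) hu'2
  have hp1 : 0 ≤ osPairingSeq ρ β F F (2 * u + 1) :=
    osPairingSeq_odd_nonneg ρ hL hm hρ hβ hFm hFb hFs (n := u) hu1 (by omega)
  have hp2 : 0 ≤ osPairingSeq ρ β F₂ F₂ (2 * u' + 1) :=
    osPairingSeq_odd_nonneg ρ hL hm hρ hβ hGm hGb hGs (n := u') hu'1 (by omega)
  have hexp : K₁ * ϑ ^ (2 * u + 1) * (K₂ * ϑ ^ (2 * u' + 1)) = K₁ * K₂ * ϑ ^ (2 * n) := by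
    rw [show K₁ * ϑ ^ (2 * u + 1) * (K₂ * ϑ ^ (2 * u' + 1)) =
      K₁ * K₂ * (ϑ ^ (2 * u + 1) * ϑ ^ (2 * u' + 1)) by ring, ← pow_add]
    congr 2
    omega
  calc osPairingSeq ρ β F F₂ n ^ 2
      ≤ osPairingSeq ρ β F F (2 * u + 1) * osPairingSeq ρ β F₂ F₂ (2 * u' + 1) := hS
    _ ≤ K₁ * ϑ ^ (2 * u + 1) * (K₂ * ϑ ^ (2 * u' + 1)) :=
        mul_le_mul hb1 hb2 hp2 (hp1.trans hb1)
    _ = K₁ * K₂ * ϑ ^ (2 * n) := hexp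

/-- The mixed bound in square-root form: `|P_{F,G}(n)| ≤ √(K₁ K₂) ϑⁿ`. -/
theorem osPairingSeq_mixed_abs_le {m : ℕ} (hL : L = 2 * m + 1) (hρ : Continuous ρ) {β : ℝ}
    (hβ : 0 ≤ β) {F F₂ : GaugeConfig d L G → ℝ} (hFm : Measurable F)
    (hFb : ∃ C : ℝ, ∀ U, |F U| ≤ C) {T'₁ T₁ : ℕ} (hFs : DependsOn F (slabEdges T'₁ T₁))
    (hGm : Measurable F₂) (hGb : ∃ C : ℝ, ∀ U, |F₂ U| ≤ C) {T'₂ T₂ : ℕ}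
    (hGs : DependsOn F₂ (slabEdges T'₂ T₂)) (hT₁ : 2 * T₁ + 2 ≤ m) (hT₂ : 2 * T₂ + 2 ≤ m)
    {K₁ K₂ ϑ : ℝ} (hϑ : 0 < ϑ)
    (h₁ : ∀ j, Odd j → 2 * T'₁ + 1 ≤ j → j ≤ m + 1 → osPairingSeq ρ β F F j ≤ K₁ * ϑ ^ j)
    (h₂ : ∀ j, Odd j → 2 * T'₂ + 1 ≤ j → j ≤ m + 1 → osPairingSeq ρ β F₂ F₂ j ≤ K₂ * ϑ ^ j)
    {n : ℕ} (hn1 : 2 * T'₁ + 2 ≤ n) (hn1' : 2 * T'₂ + 2 ≤ n) (hn2 : n ≤ m) :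
    |osPairingSeq ρ β F F₂ n| ≤ Real.sqrt (K₁ * K₂) * ϑ ^ n := by
  have hsq := osPairingSeq_mixed_sq_le ρ hL hρ hβ hFm hFb hFs hGm hGb hGs hT₁ hT₂ h₁ h₂ hn1
    hn1' hn2
  have hK₂ : 0 ≤ K₁ * K₂ := by
    -- `K₁ K₂ ϑ^{2n} ≥ P² ≥ 0` and `ϑ > 0`
    have hpos : 0 < ϑ ^ (2 * n) := pow_pos hϑ _
    nlinarith [sq_nonneg (osPairingSeq ρ β F F₂ n)]
  apply abs_le_of_sq_le_sq _ (mul_nonneg (Real.sqrt_nonneg _) (pow_nonneg hϑ.le _))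
  rw [mul_pow, Real.sq_sqrt hK₂, ← pow_mul, mul_comm n 2]
  exact hsq

end Summit.QuantumFields.YangMills.Theorems.SoloBlind

end
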